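import Mathlib
import Summits.NavierStokesRegularity.NavierStokesRegularity.Theorems.TaoLadderRungTwoBreakOneShiftT4W76Defs
import HarnessLib

/-!
# The one-shift instance T4 @ ε₀ = 1/10, W = 76 — REPLAY-SIZED VARIANT (R) of the DEFINITIONS: a wide hull of the
# renormalisation factor and generous certificate-side constants, with the window data UNCHANGED
# (cell harvest/h2-tao-ladder, seat p2; rung1/RUNG1-P2G15-REPORT.md §75(4), rung1/RUNG1-P2G16-REPORT.md §79;
# support for K1(1) = `NoSurvivingDSSOne`, stmt-NavierStokesRegularity-20205)

MODEL lattice only (the comparable circuit table T4 on Tao's shift set, scale ratio `1 + ε₀ = 11/10`); nothing here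
is a statement about the Navier–Stokes equations; nothing is asserted — this module only DEFINES.

Why a variant.  Module `…OneShiftT4W76Defs` fixed the hull `[gLo, gHi] = [1.0339432745, 1.0339432767]` of the
renormalisation factor `g` (the interval engine's own hull rounded outward by `7·10⁻¹¹`) and module `…T4W76WindowCert`
fixed the eight certificate-side constants (`Z = 8.62·10⁻⁴`, …) at the engine's printed numbers.  The KERNEL replay of
the row (p2 g15: emitter + `native_decide` evaluation of the kernel's own Booleans) encloses `g` in
`[1.0339432731, 1.0339432781]` — NOT inside `[gLo, gHi]` — and its window block constant is `Z = 1.1238·10⁻³ > 8.62·10⁻⁴`: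
the replay's boxes are up to `1.86×` the engine's, so no kernel evaluation can serve constants that were rounded from the
engine's output with `< 10⁻⁴` relative room.  The one-shift Banach argument (`…_v7s`) does not need that sharpness: its
rows close with orders of magnitude to spare in every certificate-side constant.  This variant therefore keeps EVERY
datum the kernel replay reads (box data, `ĝ`, `κ`, `c_max`, `Q`, `S`, `ε`, `ε′`, `ā_t`, `τ̂ ± r_τ`, the table, the
term-data presentation `presT4` with its wake radius literal `⌈g_hi (r₀+κ) 2⁶⁰⌉ 2⁻⁶⁰`) and changes only frame CHOICES:

* hull `[gLo, gHi] = [1.03393, 1.03395]` (half-width `10⁻⁵` around `ĝ = 1.0339432756`; the replay's hull has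
  half-width `2.5·10⁻⁹`), hence `θ = 2 gHi`, `β = 1.01 gHi`;
* wake radius offset `r₀ = 8.16·10⁻⁵` (was `8.17·10⁻⁵`) so that `gHi (r₀ + κ) = 1.70891·10⁻⁴ ≤ 197142128377967·2⁻⁶⁰`
  — the wake-edge radius literal of `T4W76.presT4` is still an upper bound, so the replay's term data are unchanged;
* top geometric ratios `ϑ = ϑ_R = 1/16` (were `1/2`; shell `W = 76` values unchanged), which frees the top rows;
* window amplitude hulls `A = Q = 0.684` on shell `0`, `1` on shells `1…74` (never read by a row), `ā_t` on shell `75`;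
* per-shell window Lipschitz numbers `(10⁻³, 10⁻³, 10²⁰)` on shell `0`, `(1, 1, 10²⁸)` inside, `(10⁻¹², 10⁻¹², 10¹⁸)`
  on shell `75` (engine: `(6.76e-10, 4.1e-5, 1e-60) / (1e-9, 1e-14, 1e-59) / (1.01e-24, 2e-44, 2.2e-21)`).

The remaining generous clause constants (`Z = 1/50`, `S_b = 1/20`, `S_e = 10²⁸`, `γ = (10⁻⁶, 10⁻⁶, 10²²)`,
shell-0 `(10⁻³, 10⁻³, 10²⁰)`, `A₁ = 10⁻⁵`) live in `…T4W76R` / `…T4W76RClauses`.  Exact-rational twin of all 76 row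
checks with these constants: harvest/h2-tao-ladder rung1/num4c/inst_T4W76R_exact.py (all OK; tightest certificate
margins: top rows `5.4×`, hull self-map row `1.8×`, window row `4×`, bottom row `300×`).
-/

noncomputable section

-- the sub-problem namespace repeats the summit name by design (D-0017)
set_option linter.dupNamespace false

namespace Summit.NavierStokesRegularity.NavierStokesRegularity.Theorems

namespace DSSOneShift

open Set Literature.Analysis.FluidPDE Literature.Analysis.FluidPDE.TaoCascade

namespace T4W76R

open T4W76 (ghat κw cmax Q S εR ωt abart τc rτ αT4 BoxData tubeCT4 half_pow_mul_le_one)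

/-! ### Scalars of the variant (exact rationals) -/

/-- Upper end of the WIDE hull of the renormalisation factor `g` (replay: `g ≤ 1.0339432781`). [cite: Tao2016AveragedNS, §5.3 (rescaling between epochs); cell vocabulary, harvest/h2-tao-ladder rung1/RUNG1-P2G15-REPORT.md §75(4)] -/
def gHi : ℝ := 103395 / 10 ^ 5

/-- Lower end of the WIDE hull of `g` (replay: `g ≥ 1.0339432731`). [cite: Tao2016AveragedNS, §5.3; cell vocabulary, harvest/h2-tao-ladder rung1/RUNG1-P2G15-REPORT.md §75(4)] -/
def gLo : ℝ := 103393 / 10 ^ 5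

/-- Wake weight ratio `θ = 2 gHi`. [cite: Tao2016AveragedNS, §4; cell vocabulary, harvest/h2-tao-ladder rung1/STAGE3-BANACH.md §1] -/
def θw : ℝ := 2 * gHi

/-- Wake amplitude ratio `β = gHi (1 + 1/100)`. [cite: Tao2016AveragedNS, §4; cell vocabulary, harvest/h2-tao-ladder rung1/INSTANCE-SHEET-T4-0.1-W76.md (δ′ = 0.01)] -/
def βw : ℝ := gHi * (1 + 1 / 100)

/-- Wake radius offset `r₀ = 8.16·10⁻⁵` (so that `gHi (r₀ + κ) ≤ 197142128377967·2⁻⁶⁰`, the wake-edge radius literal of `T4W76.presT4`). [cite: Tao2016AveragedNS, §4; cell vocabulary, harvest/h2-tao-ladder rung1/RUNG1-P2G16-REPORT.md §79] -/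
def r₀ : ℝ := 816 / 10 ^ 7

/-- Top geometric ratio `ϑ = ϑ_R = 1/16` of the variant's top weights / tube radii / amplitude hulls. [cite: Tao2016AveragedNS, §4; cell vocabulary, harvest/h2-tao-ladder rung1/STAGE3-BANACH.md §1] -/
def ϑt : ℝ := 1 / 16

/-! ### Closed-form tails of the variant frame -/

/-- Metric weights: `θ^{|k|}` on the wake, `ε′ ϑ^{k-76}` on the top, `1` on the window. [cite: Tao2016AveragedNS, §4; cell vocabulary, harvest/h2-tao-ladder rung1/STAGE3-BANACH.md §1] -/
def wtT4 (k : ℤ) : ℝ :=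
  if k < 0 then θw ^ (-k).toNat else if 76 ≤ k then ωt * ϑt ^ (k - 76).toNat else 1

/-- Tube radii: `gHi^{|k|} (r₀ + κ |k|)` on the wake, `ε ϑ^{k-76}` on the top, `0` on the window. [cite: Tao2016AveragedNS, §4; cell vocabulary, harvest/h2-tao-ladder rung1/STAGE2-LEMMA.md §5] -/
def tubeRT4 (k : ℤ) : ℝ :=
  if k < 0 then gHi ^ (-k).toNat * (r₀ + κw * ((-k).toNat : ℝ))
  else if 76 ≤ k then εR * ϑt ^ (k - 76).toNat else 0

/-- The weights are positive. [folklore] -/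
theorem wtT4_pos (k : ℤ) : 0 < wtT4 k := by
  unfold wtT4 θw gHi ϑt T4W76.ωt
  split_ifs <;> positivity

/-- The tube radii are non-negative. [folklore] -/
theorem tubeRT4_nonneg (k : ℤ) : 0 ≤ tubeRT4 k := by
  unfold tubeRT4 gHi r₀ ϑt T4W76.κw T4W76.εR
  split_ifs <;> positivity

/-- `tubeR ≤ 2 · wt` (bounded-metric constant `B = 2`). [cite: Tao2016AveragedNS, §4; cell vocabulary, harvest/h2-tao-ladder rung1/STAGE3-BANACH.md §1 (B_w, B_t)] -/
theorem tubeRT4_le (k : ℤ) : tubeRT4 k ≤ 2 * wtT4 k := by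
  unfold tubeRT4 wtT4
  split_ifs with h1 h2
  · -- wake: gHi^n (r₀ + κ n) ≤ 2 (2 gHi)^n, from (1/2)^n n ≤ 1
    set n := (-k).toNat
    have hθ : θw ^ n = 2 ^ n * gHi ^ n := by rw [θw, mul_pow]
    rw [hθ]
    have hg : 0 < gHi ^ n := by unfold gHi; positivity
    have hn := half_pow_mul_le_one n
    have h2n : (1 : ℝ) ≤ 2 ^ n := one_le_pow₀ (by norm_num)
    have hkey : r₀ + κw * (n : ℝ) ≤ 2 * 2 ^ n := by
      rw [one_div, inv_pow, inv_mul_le_iff₀ (by positivity)] at hn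
      unfold r₀ T4W76.κw; nlinarith
    calc gHi ^ n * (r₀ + κw * (n : ℝ)) ≤ gHi ^ n * (2 * 2 ^ n) := mul_le_mul_of_nonneg_left hkey hg.le
      _ = 2 * (2 ^ n * gHi ^ n) := by ring
  · unfold T4W76.εR T4W76.ωt
    have : (0 : ℝ) ≤ ϑt ^ (k - 76).toNat := by unfold ϑt; positivity
    nlinarith
  · norm_num

/-- `|tubeC| ≤ 2 · wt` when `|ŷ_{·,0}| ≤ cmax` (tube centres `ĝ^{|k|} ŷ_{i,0}` as in `…T4W76Defs`). [cite: Tao2016AveragedNS, §4; cell vocabulary, harvest/h2-tao-ladder rung1/STAGE3-BANACH.md §1] -/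
theorem tubeCT4_le {c₀ : Fin 4 → ℝ} (hc : ∀ i, |c₀ i| ≤ cmax) (i : Fin 4) (k : ℤ) :
    |tubeCT4 c₀ i k| ≤ 2 * wtT4 k := by
  unfold T4W76.tubeCT4 wtT4
  split_ifs with h1 h2
  · set n := (-k).toNat
    have hci := hc i
    unfold T4W76.cmax at hci
    rw [abs_mul, abs_of_nonneg (by unfold T4W76.ghat; positivity)]
    have hpow : ghat ^ n ≤ θw ^ n :=
      pow_le_pow_left₀ (by unfold T4W76.ghat; norm_num) (by unfold T4W76.ghat θw gHi; norm_num) n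
    have hθ0 : 0 ≤ θw ^ n := by unfold θw gHi; positivity
    calc ghat ^ n * |c₀ i| ≤ θw ^ n * 1 := mul_le_mul hpow (by linarith [abs_nonneg (c₀ i)]) (abs_nonneg _) hθ0
      _ ≤ 2 * θw ^ n := by linarith
  · simp only [abs_zero]; unfold T4W76.ωt ϑt; positivity
  · norm_num

/-- **The frame of the variant**: window `[0, 76)`, the certificate's box (the SAME `BoxData` as `…T4W76Defs`), flight
time `τc ± rτ`, the closed-form tubes and weights above, `B = 2`, edge sup bounds `Eb = 7/10`, `Et = ε`.
[cite: Tao2016AveragedNS, §4, §5.3; cell vocabulary, harvest/h2-tao-ladder rung1/INSTANCE-SHEET-T4-0.1-W76.md (Frame)] -/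
def frame (bd : BoxData) : OneShiftFrame 4 where
  W := 76
  D := bd.D
  yc := bd.yc
  a := bd.a
  τc := τc
  rτ := rτ
  tubeC := tubeCT4 fun i => bd.yc i 0
  tubeR := tubeRT4
  wt := wtT4
  B := 2
  Eb := 7 / 10
  Et := εR
  strig := bd.strig
  a_pos := bd.a_pos
  rτ_pos := by unfold T4W76.rτ; norm_num
  τc_gt := by unfold T4W76.rτ T4W76.τc; norm_num
  wt_pos := wtT4_pos
  tubeR_nonneg := tubeRT4_nonneg
  tubeR_le := tubeRT4_le
  tubeC_le := tubeCT4_le bd.yc_le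

/-! ### The functions fed to `…_v7s` -/

/-- Amplitude hulls `A`: `Q β^{|k|}` (wake), `ε ϑ^{k-76}` (top), and on the window `Q` (shell 0), `ā_t` (shell 75),
`1` (shells 1 … 74, never read by a row). [cite: Tao2016AveragedNS, §4 Lemma 4.1 (4.5); cell vocabulary, harvest/h2-tao-ladder rung1/RUNG1-P2G16-REPORT.md §79] -/
def AT4 (k : ℤ) : ℝ :=
  if k < 0 then Q * βw ^ (-k).toNat
  else if 76 ≤ k then εR * ϑt ^ (k - 76).toNat
  else if k = 0 then Q else if k = 75 then abart else 1

/-- Time-Lipschitz rate envelopes `R` (table-sparse form of `…_v7s`): `(S Q² β²)(β²/Λ₀)^{|k|}` on the wake,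
`(S ā_t² Λ₀^76)(Λ₀ ϑ²)^{k-76}` on the top, `0` on the window. [cite: Tao2016AveragedNS, §4 Lemma 4.1 (4.8); cell vocabulary, module …OneShiftSparseClosedForm (hRW/hRT)] -/
def RT4 (k : ℤ) : ℝ :=
  if k < 0 then (S * Q ^ 2 * βw ^ 2) * (βw ^ 2 * (bigLam (1 / 10))⁻¹) ^ (-k).toNat
  else if 76 ≤ k then (S * abart ^ 2 * bigLam (1 / 10) ^ 76) * (bigLam (1 / 10) * ϑt ^ 2) ^ (k - 76).toNat
  else 0

/-- Per-shell window Lipschitz numbers w.r.t. the point distance (three pieces: `10⁻³ / 1 / 10⁻¹²`). [cite: Tao2016AveragedNS, §4; cell vocabulary, harvest/h2-tao-ladder rung1/RUNG1-P2G16-REPORT.md §79] -/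
def vmaxT4 (k : ℤ) : ℝ :=
  if k = 0 then 1 / 10 ^ 3 else if k = 75 then 1 / 10 ^ 12 else 1

/-- Per-shell window Lipschitz numbers w.r.t. the wake-edge input (three pieces: `10⁻³ / 1 / 10⁻¹²`). [cite: Tao2016AveragedNS, §4; cell vocabulary, harvest/h2-tao-ladder rung1/RUNG1-P2G16-REPORT.md §79] -/
def χbT4 (k : ℤ) : ℝ :=
  if k = 0 then 1 / 10 ^ 3 else if k = 75 then 1 / 10 ^ 12 else 1

/-- Per-shell window Lipschitz numbers w.r.t. the top-edge input (three pieces: `10²⁰ / 10²⁸ / 10¹⁸`). [cite: Tao2016AveragedNS, §4; cell vocabulary, harvest/h2-tao-ladder rung1/RUNG1-P2G16-REPORT.md §79] -/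
def χeT4 (k : ℤ) : ℝ :=
  if k = 0 then 10 ^ 20 else if k = 75 then 10 ^ 18 else 10 ^ 28

end T4W76R

end DSSOneShift

end Summit.NavierStokesRegularity.NavierStokesRegularity.Theorems
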